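import Mathlib
import HarnessLib
import Summits.HubbardSuperconductivity.HubbardSuperconductivity.Theorems.KLProgrammeKLRegimeTwoVolumeModelStepLinear
import Summits.HubbardSuperconductivity.HubbardSuperconductivity.Theorems.KLProgrammeKLRegimeTwoVolumeTowerStep
import Summits.HubbardSuperconductivity.HubbardSuperconductivity.Theorems.KLProgrammeKLRegimeTwoVolumeTowerTruncKit
import Summits.HubbardSuperconductivity.HubbardSuperconductivity.Theorems.KLProgrammeKLRegimeTwoVolumeTowerSrcScaledKit

/-!
# Route `KLProgramme` — crux K3, VL child `KLRegimeVolumeLimitV17F2` (stmt-HubbardSuperconductivity-20440), blueprint v5 M5 / W5-TS: THE MODEL STEP ON THE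
# SOURCE-RESCALED TRUNCATED TOWER (located «SRC-DEG2», cure (β) of plan g22 (R171); seat hubbard-kl-k3c4-p1 g15; `--supports` 20440)

Twin of `…TwoVolumeTowerTruncStep.towerTrunc_twoVolume_scaleSucc_le_eps_mul_linear` (p617603) for the SOURCE-RESCALED truncated states
`srcTrunc 3 (klTowerStateS V … K t j)` (`…TowerSrcScaledDefs`, [BGM06] §2.9 (4.6)–(4.8): the source legs are dead variables and are rescaled by `t`):
`…TwoVolumeModelStepLinear.model_twoVolume_scaleSucc_le_eps_mul_linear` (p597127, generic in the two input actions) instantiated at the rescaled truncated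
states, whose re-analysis `map T_j (srcTrunc 3 (S-state j)) = srcTrunc 3 (klTowerDS … t j)` (`…TowerSrcScaledKit.srcTrunc_klTowerDS_eq_map`) is the object
the rescaled profiles are asked of; the next rescaled truncated states are `srcTrunc 3` of the step's output (`…TowerSrcScaledKit.srcTrunc_klTowerStateS_succ`),
and keyed defects only decrease under truncation.  Statement = p617603's with `klTowerState ↦ klTowerStateS … t`, `klTowerD ↦ klTowerDS … t`.

* **`towerTruncS_twoVolume_scaleSucc_le_eps_mul_linear`**.

Proofs only; no definition.
-/

noncomputable section

namespace Summit.HubbardSuperconductivity.HubbardSuperconductivity.Theorems.TwoVolumeSource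

set_option linter.dupNamespace false -- summit = problem name (single-conjunct summit), D-0017

open Finset Literature.MathematicalPhysics.QuantumLattice GrassmannAlgebra Literature.Probability.LatticeModels
  Literature.Probability.LatticeModels.BattleFederbush
open Summit.HubbardSuperconductivity.HubbardSuperconductivity.Theorems.TwoPointAssembly
open Summit.HubbardSuperconductivity.HubbardSuperconductivity.Theorems.KLRegimeSplit
open Summit.HubbardSuperconductivity.HubbardSuperconductivity.Theorems.KLProgrammeLegKernels
open Summit.HubbardSuperconductivity.HubbardSuperconductivity.Theorems.EngineV8
open Summit.HubbardSuperconductivity.HubbardSuperconductivity.Theorems.TwoVolumeDefect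

/-- **THE MODEL STEP ON THE SOURCE-RESCALED TRUNCATED TOWER** (see the module docstring): for the coarse volume `L` at frame `K`, the fine volume `L″ = bL` at its own frame `K″`
(and, for the common-frame comparison, at `K`), scale `j`, an `(R+R′)`-deep pin `w` and a degree `n+1`, the keyed two-volume defect of the NEXT states
`(klTowerState L″ … K″ (j+1), klTowerState L … K (j+1))` is at most `ε ×` the volume-free linear form of p597127 in the scale-`j` data.
[folklore: instantiation; cite: BenfattoGiulianiMastropietro2006, §2.7-§2.9 and §3] -/
theorem towerTruncS_twoVolume_scaleSucc_le_eps_mul_linear {b L Lf M : ℕ} [NeZero Lf] [NeZero L] [NeZero M] (U μ : ℝ) (K K'' : TrigPolyC4v) (t : ℝ) (j : ℕ)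
    (hLf : Lf = b * L) {β : ℝ} (hβ : β ≠ 0) {Λ : ℝ} (hΛ : 0 < Λ)
    -- the partition functions of the scales already integrated are nonzero (both volumes, own frames)
    (hZ : ∀ k, k + 1 ≤ j → hubbardEffPartitionFnCT L M β U μ 0 K (klScale klE0 (k + 1)) ≠ 0)
    (hZ'' : ∀ k, k + 1 ≤ j → hubbardEffPartitionFnCT Lf M β U μ 0 K'' (klScale klE0 (k + 1)) ≠ 0)
    -- the block structures of the scale-`j+1` and scale-`j` legs and their doublings
    (e : (SpaceTimeIdx Lf M × SectorLeg (sectorCount j)) ≃ (Fin 2 → Fin b) × (SpaceTimeIdx L M × SectorLeg (sectorCount j)))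
    (he1 : ∀ X' i, ((e X').1 i : ℕ) = (X'.1.2 i).val / L) (he2 : ∀ X', (e X').2 = ((X'.1.1, fun i => (((X'.1.2 i).val : ℕ) : ZMod L)), X'.2))
    (ed : SrcLabel Lf M j ≃ (Fin 2 → Fin b) × SrcLabel L M j) (hed : ∀ x s, ed (x, s) = ((e x).1, ((e x).2, s)))
    (e₁ : (SpaceTimeIdx Lf M × SectorLeg (sectorCount (j - 1))) ≃ (Fin 2 → Fin b) × (SpaceTimeIdx L M × SectorLeg (sectorCount (j - 1))))
    (he₁1 : ∀ X' i, ((e₁ X').1 i : ℕ) = (X'.1.2 i).val / L) (he₁2 : ∀ X', (e₁ X').2 = ((X'.1.1, fun i => (((X'.1.2 i).val : ℕ) : ZMod L)), X'.2))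
    (ed₁ : SrcLabel Lf M (j - 1) ≃ (Fin 2 → Fin b) × SrcLabel L M (j - 1)) (hed₁ : ∀ x s, ed₁ (x, s) = ((e₁ x).1, ((e₁ x).2, s)))
    -- the region schedule and the pin
    (R R' RN RZ RF r : ℕ) (hNZ : RN ≤ RZ) (hrN : r ≤ RN) (hrF : r ≤ RF) (hrZR : r + RZ ≤ R)
    (w : SrcLabel Lf M j) (hw : ∀ i, R + R' ≤ (w.1.1.2 i).val % L ∧ (w.1.1.2 i).val % L + (R + R') < L)
    -- THE NORMALISATION `ε`; ONE-VOLUME COVARIANCE DATA at the common frame `K` (coarse, fine, fine sectional), the fine transfer at `K`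
    {ε : ℝ} (hε : 0 < ε)
    {κ κ' aW aW' sW sW' eW' : ℝ} (hC : ScaleCovData (klStepCov L M β μ K j) Λ κ (aW / ε) sW) (hC' : ScaleCovData (klStepCov Lf M β μ K j) Λ κ' (aW' / ε) sW')
    (hCsec : ScaleCovSecData (klStepCov Lf M β μ K j) Λ eW')
    {ΛT cW : ℝ} (hTr : TransferWtData (klTowerTransfer Lf M β μ K j) ed ed₁ ΛT cW)
    -- the two states of step `j` (coarse at `K`, fine at its own frame `K″`): parity, normalised raw profiles, E1's even profile of `klTowerD L … K j`
    (h𝒲e : klTowerStateS L M β U μ K t j ∈ evenOdd ℂ 0) (h𝒲0 : constPart ℂ (klTowerStateS L M β U μ K t j) = 0)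
    (h𝒲'e : klTowerStateS Lf M β U μ K'' t j ∈ evenOdd ℂ 0) (h𝒲'0 : constPart ℂ (klTowerStateS Lf M β U μ K'' t j) = 0)
    (hZs : hubbardEffPartitionFnCT L M β U μ 0 K (klScale klE0 (j + 1)) ≠ 0) (hZs'' : hubbardEffPartitionFnCT Lf M β U μ 0 K'' (klScale klE0 (j + 1)) ≠ 0)
    {Λ₁ : ℝ} (hΛ₁ : 0 ≤ Λ₁) (hΛT : Λ ≤ ΛT) (hΛΛ₁ : Λ ≤ Λ₁) (N𝒲 NV N𝒲' : ℕ → ℝ) (hNV0 : ∀ m', 0 ≤ NV m') (hN𝒲'0 : ∀ k, 0 ≤ N𝒲' k)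
    (hN𝒲 : WtProfileRaw (srcTrunc ℂ (fun q : SrcLabel L M (j - 1) => q.2 = 1) 3 (klTowerStateS L M β U μ K t j)) Λ₁ (fun k => ε * N𝒲 k))
    (hNV : WtProfileEven (srcTrunc ℂ (fun q : SrcLabel L M j => q.2 = 1) 3 (klTowerDS L M β U μ K t j)) Λ (fun m' => ε * NV m'))
    (hN𝒲' : WtProfileRaw (srcTrunc ℂ (fun q : SrcLabel Lf M (j - 1) => q.2 = 1) 3 (klTowerStateS Lf M β U μ K'' t j)) Λ₁ (fun k => ε * N𝒲' k))
    -- the scale-`j` TWO-VOLUME data (normalised): deep `ε·Ej`, everywhere `ε·NDj`; the normalised transfer majorant `Ein`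
    (Ej NDj : ℕ → ℝ)
    (hD : KeyedDefectData (N := sectorCount j) ed₁ (srcTrunc ℂ (fun q : SrcLabel Lf M (j - 1) => q.2 = 1) 3 (klTowerStateS Lf M β U μ K'' t j))
      (srcTrunc ℂ (fun q : SrcLabel L M (j - 1) => q.2 = 1) 3 (klTowerStateS L M β U μ K t j)) R RF (fun k => ε * Ej k) (fun k => ε * NDj k))
    (Ein : ℕ → ℝ) (hEin0 : ∀ m', 0 ≤ Ein m')
    (hEin : ∀ m', 1 ≤ m' → ∀ n : ℕ, 2 * m' = n + 1 →
      cW ^ n * (cW * Ej (n + 1) + cW / (1 + ΛT * ((r : ℝ) + 1)) * NDj (n + 1)) +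
        (2 * cW ^ n * (cW / (1 + ΛT * ((r : ℝ) + 1))) * N𝒲 (n + 1) +
          n * cW ^ n * (5 * (cW / (1 + ΛT * ((r : ℝ) + 1))) * N𝒲 (n + 1) + 2 * cW * ((1 + Λ₁ * (((RZ - RN : ℕ) : ℝ) + 1))⁻¹ * N𝒲 (n + 1)))) ≤ Ein m')
    -- THE FINE VOLUME'S OWN-FRAME MISMATCH DATA (`K″` against `K`): Gram path, entry sup `sE`, rows `cR/ε, cC/ε`, transfer rows/cols `δ`; volume-free caps
    {κf sE cR cC cRb cCb δ δb : ℝ} (hκf : 0 < κf)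
    (hGBf : ∀ t ∈ Set.Icc (0 : ℝ) 1, IsGramBoundedR (klStepCov Lf M β μ K j + t • (klStepCov Lf M β μ K'' j - klStepCov Lf M β μ K j)) κf)
    (hsE0 : 0 ≤ sE) (hsE : ∀ x y, ‖(klStepCov Lf M β μ K'' j - klStepCov Lf M β μ K j) x y‖ ≤ sE) (hcR : 0 ≤ cR) (hcC : 0 ≤ cC) (hcRb : cR ≤ cRb) (hcCb : cC ≤ cCb)
    (hER : ∀ x, ∑ y, ‖(klStepCov Lf M β μ K'' j - klStepCov Lf M β μ K j) x y‖ ≤ cR / ε)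
    (hEC : ∀ y, ∑ x, ‖(klStepCov Lf M β μ K'' j - klStepCov Lf M β μ K j) x y‖ ≤ cC / ε)
    (hδ : 0 ≤ δ) (hδb : δ ≤ δb) (hδrow : ∀ x, ∑ y, ‖klTowerTransfer Lf M β μ K'' j x y - klTowerTransfer Lf M β μ K j x y‖ ≤ δ)
    (hδcol : ∀ y, ∑ x, ‖klTowerTransfer Lf M β μ K'' j x y - klTowerTransfer Lf M β μ K j x y‖ ≤ δ)
    -- FIELD RADII, VOLUME-FREE MAJORANTS OF THE FIELD-WEIGHTED NORMS OF THE BUDGETS, BARRED SMALLNESS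
    {ρ₀ ρf ρ₂ ρ' ρ₃ ν₀ ν₁ ν₂ ν₃ ν₄ ν₅ νE ν₆ ν₇ ν₈ : ℝ} (hρ₀ : 0 < ρ₀) (hρf : 0 < ρf) (hρ₂ : 0 < ρ₂) (hρ' : 0 < ρ') (hρ₃ : 0 < ρ₃)
    (hν₀ : normV (SrcLabel L M j) κ ρ₀ NV ≤ ν₀) (hθ₀ : Real.exp 1 * aW * ν₀ / κ ^ 2 < 1)
    (Nw₁ : ℕ → ℝ) (hNw₁ : ∀ m', Nw₁ m' = ρ₀⁻¹ ^ (2 * m') * (Real.exp 1 * ν₀) / (1 - Real.exp 1 * aW * ν₀ / κ ^ 2))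
    (hν₅ : normV (SrcLabel Lf M j) (κ' + κ) ρf Nw₁ ≤ ν₅) (hθw : Real.exp 1 * (aW' + aW + (aW' + aW)) * ν₅ / (κ' + κ) ^ 2 < 1)
    (hν₄ : normV (SrcLabel Lf M j) (κ' + κ + (κ' + κ + (κ' + κ))) ρ₂ Nw₁ ≤ ν₄)
    (hθ₂ : Real.exp 1 * (aW' + aW + (aW' + aW)) * ν₄ / (κ' + κ + (κ' + κ + (κ' + κ))) ^ 2 < 1)
    (NW' : ℕ → ℝ) (hNW'def : ∀ m', NW' m' = cW ^ (2 * m' - 1) * (cW * N𝒲' (2 * m')))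
    (hν₁ : normV (SrcLabel Lf M j) κ' ρ' (fun m' => NV m' + (NW' m' + NV m')) ≤ ν₁) (hν₂ : normV (SrcLabel Lf M j) κ' ρ' (fun m' => NW' m' + NV m') ≤ ν₂)
    (hν₃ : normV (SrcLabel Lf M j) κ' ρ' NV ≤ ν₃) (hνE : normV (SrcLabel Lf M j) κ' ρ' Ein ≤ νE)
    (hbar : Real.exp 1 * aW' * (ν₁ + νE) / κ' ^ 2 < 1) (hθ₂' : Real.exp 1 * aW' * (ν₃ + ν₂) / κ' ^ 2 < 1)
    (hν₆ : normV (SrcLabel Lf M j) κf ρ₃ (fun m' => NW' m' + (2 * m' : ℕ) * (cW + δb) ^ (2 * m' - 1) * δb * N𝒲' (2 * m')) ≤ ν₆)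
    (hν₇ : normV (SrcLabel Lf M j) κf ρ₃ NW' ≤ ν₇)
    (hν₈ : normV (SrcLabel Lf M j) κf ρ₃ (fun m' => (2 * m' : ℕ) * (cW + δb) ^ (2 * m' - 1) * N𝒲' (2 * m')) ≤ ν₈)
    (hθf₁ : Real.exp 1 * (aW' + (cRb + cCb)) * ν₆ / κf ^ 2 < 1) (hθf₂ : Real.exp 1 * aW' * (ν₇ + δb * ν₈) / κf ^ 2 < 1)
    (n : ℕ) (p : Fin (n + 1)) :
    ∑ X ∈ univ.filter (fun X : Fin (n + 1) → SrcLabel Lf M j => X p = w),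
        ‖kernel ℂ (srcTrunc ℂ (fun q : SrcLabel Lf M j => q.2 = 1) 3 (klTowerStateS Lf M β U μ K'' t (j + 1))) (n + 1) X -
          (if ∀ i, (ed (X i)).1 = (ed (X p)).1 then
            kernel ℂ (srcTrunc ℂ (fun q : SrcLabel L M j => q.2 = 1) 3 (klTowerStateS L M β U μ K t (j + 1))) (n + 1) (fun i => (ed (X i)).2) else 0)‖ ≤
      ε * (((ρ'⁻¹ ^ (n + 1) * Real.exp 1 / (1 - Real.exp 1 * aW' * (ν₁ + νE) / κ' ^ 2) ^ 2)) * normV (SrcLabel Lf M j) κ' ρ' Ein +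
        ((ρ'⁻¹ ^ (n + 1) * (Real.exp 1 * ν₂) / (1 - Real.exp 1 * aW' * (ν₃ + ν₂) / κ' ^ 2) ^ 2)) * (1 + Λ * ((R' : ℝ) + 1))⁻¹ +
        ((((((n + 1 + 1) * (n + 1 + 2) : ℕ) : ℝ) / 2 *
            (ρ₂⁻¹ ^ (n + 3) * (Real.exp 1 * ν₄) / (1 - Real.exp 1 * (aW' + aW + (aW' + aW)) * ν₄ / (κ' + κ + (κ' + κ + (κ' + κ))) ^ 2)))) +
          (((((n + 1 + 1) * (n + 1 + 2) : ℕ) : ℝ) / 2 * (ρ₃⁻¹ ^ (n + 3) * (Real.exp 1 * ν₆) / (1 - Real.exp 1 * (aW' + (cRb + cCb)) * ν₆ / κf ^ 2))) +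
           (‖(2 : ℂ)⁻¹‖ * ∑ a' ∈ range (n + 2), ∑ b' ∈ range (n + 2),
          (if a' + b' = n + 1 then (((a' + 1) * (b' + 1) : ℕ) : ℝ) *
            ((ρ₃⁻¹ ^ (a' + 1) * (Real.exp 1 * ν₆) / (1 - Real.exp 1 * (aW' + (cRb + cCb)) * ν₆ / κf ^ 2)) *
              (ρ₃⁻¹ ^ (b' + 1) * (Real.exp 1 * ν₆) / (1 - Real.exp 1 * (aW' + (cRb + cCb)) * ν₆ / κf ^ 2))) else 0)) +
           (ρ₃⁻¹ ^ (n + 1) * (Real.exp 1 * ν₈) / (1 - Real.exp 1 * aW' * (ν₇ + δb * ν₈) / κf ^ 2) ^ 2))) * (eW' / (1 + Λ * ((R : ℝ) + 1)) + (sE + (cR + cC) + δ)) +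
        ((‖(2 : ℂ)⁻¹‖ * ∑ a ∈ range (n + 2), ∑ b ∈ range (n + 2),
            (if a + b = n + 1 then (((a + 1) * (b + 1) : ℕ) : ℝ) *
              (4 * (ρ₂⁻¹ ^ (a + 1) * (Real.exp 1 * ν₄) / (1 - Real.exp 1 * (aW' + aW + (aW' + aW)) * ν₄ / (κ' + κ + (κ' + κ + (κ' + κ))) ^ 2)) *
                (ρ₂⁻¹ ^ (b + 1) * (Real.exp 1 * ν₄) / (1 - Real.exp 1 * (aW' + aW + (aW' + aW)) * ν₄ / (κ' + κ + (κ' + κ + (κ' + κ))) ^ 2))) else 0))) * (aW' / (1 + Λ * ((R : ℝ) + 1))) +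
        (((((n + 1 + 1) * (n + 1 + 2) : ℕ) : ℝ) / 2 * (sW' + sW) *
              (ρf⁻¹ ^ (n + 3) * (Real.exp 1 * ν₅) / (1 - Real.exp 1 * (aW' + aW + (aW' + aW)) * ν₅ / (κ' + κ) ^ 2)) +
            ‖(2 : ℂ)⁻¹‖ * ∑ a ∈ range (n + 2), ∑ b ∈ range (n + 2),
              (if a + b = n + 1 then (((a + 1) * (b + 1) : ℕ) : ℝ) *
                (2 * (aW' + aW) * (ρf⁻¹ ^ (a + 1) * (Real.exp 1 * ν₅) / (1 - Real.exp 1 * (aW' + aW + (aW' + aW)) * ν₅ / (κ' + κ) ^ 2)) *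
                  (ρf⁻¹ ^ (b + 1) * (Real.exp 1 * ν₅) / (1 - Real.exp 1 * (aW' + aW + (aW' + aW)) * ν₅ / (κ' + κ) ^ 2))) else 0))) * (Λ * ((R' : ℝ) + 1))⁻¹) := by
  letI : LinearOrder (SrcLabel Lf M j) := LinearOrder.lift' (Fintype.equivFin (SrcLabel Lf M j)) (Fintype.equivFin _).injective
  -- the states are re-analysed with `klTowerTransfer`, whose blocks are `(Tc, Jc)`: the identity pair at `j = 0`, `(klReanalysis, klSlotShift)` at `j = k+1`
  have hZj : ∀ k, j = k + 1 → hubbardEffPartitionFnCT L M β U μ 0 K (klScale klE0 (k + 1)) ≠ 0 := fun k hk => hZ k (by omega)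
  have hZj'' : ∀ k, j = k + 1 → hubbardEffPartitionFnCT Lf M β U μ 0 K'' (klScale klE0 (k + 1)) ≠ 0 := fun k hk => hZ'' k (by omega)
  -- E1's even profile of `srcTrunc 3 (klTowerD L … K j) = map T_j (srcTrunc 3 (state j))`
  have hNV' : WtProfileEven (ExteriorAlgebra.map (Matrix.toLin' (klTowerTransfer L M β μ K j))
      (srcTrunc ℂ (fun q : SrcLabel L M (j - 1) => q.2 = 1) 3 (klTowerStateS L M β U μ K t j))) Λ (fun m' => ε * NV m') := by
    rw [← srcTrunc_klTowerDS_eq_map hβ U μ K t j 3 hZj]; exact hNV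
  -- the truncated states: parity
  have h𝒲eT : srcTrunc ℂ (fun q : SrcLabel L M (j - 1) => q.2 = 1) 3 (klTowerStateS L M β U μ K t j) ∈ evenOdd ℂ 0 :=
    (mem_evenPart_iff).1 (srcTrunc_mem_evenPart ℂ _ 3 ((mem_evenPart_iff).2 h𝒲e))
  have h𝒲0T : constPart ℂ (srcTrunc ℂ (fun q : SrcLabel L M (j - 1) => q.2 = 1) 3 (klTowerStateS L M β U μ K t j)) = 0 := constPart_srcTrunc_eq_zero ℂ _ 3 h𝒲0
  have h𝒲'eT : srcTrunc ℂ (fun q : SrcLabel Lf M (j - 1) => q.2 = 1) 3 (klTowerStateS Lf M β U μ K'' t j) ∈ evenOdd ℂ 0 :=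
    (mem_evenPart_iff).1 (srcTrunc_mem_evenPart ℂ _ 3 ((mem_evenPart_iff).2 h𝒲'e))
  have h𝒲'0T : constPart ℂ (srcTrunc ℂ (fun q : SrcLabel Lf M (j - 1) => q.2 = 1) 3 (klTowerStateS Lf M β U μ K'' t j)) = 0 :=
    constPart_srcTrunc_eq_zero ℂ _ 3 h𝒲'0
  -- the next truncated states are the truncations of the step run on the truncated states
  have hout : srcTrunc ℂ (fun q : SrcLabel L M j => q.2 = 1) 3 (klTowerStateS L M β U μ K t (j + 1)) =
      srcTrunc ℂ (fun q : SrcLabel L M j => q.2 = 1) 3 (effAction ℂ (klStepCovD L M β μ K j)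
        (ExteriorAlgebra.map (Matrix.toLin' (klTowerTransfer L M β μ K j)) (srcTrunc ℂ (fun q : SrcLabel L M (j - 1) => q.2 = 1) 3 (klTowerStateS L M β U μ K t j)))) :=
    srcTrunc_klTowerStateS_succ hβ U μ K t j 3 hZj hZs
  have hout'' : srcTrunc ℂ (fun q : SrcLabel Lf M j => q.2 = 1) 3 (klTowerStateS Lf M β U μ K'' t (j + 1)) =
      srcTrunc ℂ (fun q : SrcLabel Lf M j => q.2 = 1) 3 (effAction ℂ (klStepCovD Lf M β μ K'' j)
        (ExteriorAlgebra.map (Matrix.toLin' (klTowerTransfer Lf M β μ K'' j)) (srcTrunc ℂ (fun q : SrcLabel Lf M (j - 1) => q.2 = 1) 3 (klTowerStateS Lf M β U μ K'' t j)))) :=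
    srcTrunc_klTowerStateS_succ hβ U μ K'' t j 3 hZj'' hZs''
  rw [hout, hout'']
  -- truncating the outputs only decreases the keyed defect
  have hcopy : ∀ y : SrcLabel Lf M j, ((ed y).2).2 = y.2 := fun y => by obtain ⟨x, s⟩ := y; rw [hed]
  refine (sum_filter_norm_keyed_kernel_srcTrunc_le ed hcopy _ _ 3 (n + 1) p w).trans ?_
  -- the block pair of the transfer and its periodisation, by cases on `j`
  obtain ⟨Tc, Tf, Jc, Jf, hTpc, hTpf, hPT₀, hPJ⟩ : ∃ (Tc : Matrix (SpaceTimeIdx L M × SectorLeg (sectorCount j)) (SpaceTimeIdx L M × SectorLeg (sectorCount (j - 1))) ℂ)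
      (Tf : Matrix (SpaceTimeIdx Lf M × SectorLeg (sectorCount j)) (SpaceTimeIdx Lf M × SectorLeg (sectorCount (j - 1))) ℂ)
      (Jc : Matrix (SpaceTimeIdx L M × SectorLeg (sectorCount j)) (SpaceTimeIdx L M × SectorLeg (sectorCount (j - 1))) ℂ)
      (Jf : Matrix (SpaceTimeIdx Lf M × SectorLeg (sectorCount j)) (SpaceTimeIdx Lf M × SectorLeg (sectorCount (j - 1))) ℂ),
      (∀ p' p, klTowerTransfer L M β μ K j p' p = if p'.2 = 0 ∧ p.2 = 0 then Tc p'.1 p.1 else if p'.2 = 1 ∧ p.2 = 1 then Jc p'.1 p.1 else 0) ∧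
      (∀ p' p, klTowerTransfer Lf M β μ K j p' p = if p'.2 = 0 ∧ p.2 = 0 then Tf p'.1 p.1 else if p'.2 = 1 ∧ p.2 = 1 then Jf p'.1 p.1 else 0) ∧
      (∀ (X' : (SpaceTimeIdx Lf M × SectorLeg (sectorCount j))) (Y : (SpaceTimeIdx L M × SectorLeg (sectorCount (j - 1)))),
        ∑ Y'' ∈ univ.filter (fun Y'' : (SpaceTimeIdx Lf M × SectorLeg (sectorCount (j - 1))) => (e₁ Y'').2 = Y), Tf X' Y'' = Tc (e X').2 Y) ∧
      (∀ (X' : (SpaceTimeIdx Lf M × SectorLeg (sectorCount j))) (Y : (SpaceTimeIdx L M × SectorLeg (sectorCount (j - 1)))),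
        ∑ Y'' ∈ univ.filter (fun Y'' : (SpaceTimeIdx Lf M × SectorLeg (sectorCount (j - 1))) => (e₁ Y'').2 = Y), Jf X' Y'' = Jc (e X').2 Y) := by
    cases j with
    | zero =>
      refine ⟨1, 1, 1, 1, fun p' p => ?_, fun p' p => ?_, fun X' Y => ?_, fun X' Y => ?_⟩
      · rw [klTowerTransfer_zero]; exact one_srcLabel_apply p' p
      · rw [klTowerTransfer_zero]; exact one_srcLabel_apply p' p
      · rw [one_periodise e₁ X' Y]
        -- the two block structures on the same label type agree
        have he : (e₁ X').2 = (e X').2 := by rw [he₁2, he2]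
        rw [he]
      · rw [one_periodise e₁ X' Y]
        have he : (e₁ X').2 = (e X').2 := by rw [he₁2, he2]
        rw [he]
    | succ k =>
      refine ⟨klReanalysis L M β μ K k, klReanalysis Lf M β μ K k, klSlotShift L M k, klSlotShift Lf M k, fun p' p => ?_, fun p' p => ?_,
        fun X' Y => ?_, fun X' Y => ?_⟩
      · rw [klTowerTransfer_succ]; exact klSrcTransfer_apply β μ K k p' p
      · rw [klTowerTransfer_succ]; exact klSrcTransfer_apply β μ K k p' p
      · exact klReanalysis_periodise hLf hβ μ K k e he2 e₁ he₁2 X' Y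
      · exact klSlotShift_periodise k e he2 e₁ he₁2 X' Y
  -- §1 the model step
  have h := model_twoVolume_scaleSucc_le_eps_mul_linear (N₁ := sectorCount (j - 1)) μ K j hLf hβ hΛ e he1 he2 ed hed e₁ he₁1 he₁2 ed₁ hed₁
    (klStepCov L M β μ K j) rfl (klStepCov Lf M β μ K j) rfl (klStepCovD L M β μ K j) (klStepCovD_apply β μ K j) (klStepCovD Lf M β μ K j) (klStepCovD_apply β μ K j)
    Tc Tf hPT₀ Jc Jf hPJ (klTowerTransfer L M β μ K j) hTpc (klTowerTransfer Lf M β μ K j) hTpf R R' RN RZ RF r hNZ hrN hrF hrZR w hw hε hC hC' hCsec hTr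
    (srcTrunc ℂ (fun q : SrcLabel L M (j - 1) => q.2 = 1) 3 (klTowerStateS L M β U μ K t j)) h𝒲eT h𝒲0T
    (srcTrunc ℂ (fun q : SrcLabel Lf M (j - 1) => q.2 = 1) 3 (klTowerStateS Lf M β U μ K'' t j)) h𝒲'eT h𝒲'0T hΛ₁ hΛT hΛΛ₁ N𝒲 NV N𝒲' hNV0 hN𝒲'0 hN𝒲 hNV' hN𝒲'
    Ej NDj hD Ein hEin0 hEin
    (klStepCov Lf M β μ K'' j) (klStepCovD Lf M β μ K'' j) (klStepCovD_apply β μ K'' j) (klTowerTransfer Lf M β μ K'' j) hκf hGBf hsE0 hsE hcR hcC hcRb hcCb hER hEC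
    hδ hδb hδrow hδcol hρ₀ hρf hρ₂ hρ' hρ₃ hν₀ hθ₀ Nw₁ hNw₁ hν₅ hθw hν₄ hθ₂ NW' hNW'def hν₁ hν₂ hν₃ hνE hbar hθ₂' hν₆ hν₇ hν₈ hθf₁ hθf₂ n p
  convert h using 3

end Summit.HubbardSuperconductivity.HubbardSuperconductivity.Theorems.TwoVolumeSource

end
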